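import Literature.Combinatorics.Optimization.TracialDesigns
import Literature.Barriers.PneNP.TSPExtensionComplexityMatchingsOps
import HarnessLib

/-!
# Junta virtual positivity, part A: counting cuts by their crossing pattern against a perfect matching

Support file for the crux `TracialDecayExp20` (stmt-PneNP-19878) of route `ChebyshevTracialDesign`
(cell pnp-psdrank, local virtual positivity lemma (N1), HOME/pnp-psdrank-p1/N1-LocalVirtualPositivity.md,
Lemma 1 "pattern law", formalisation steps (i)–(ii)).

For a perfect matching `M` of a vertex set `S` and `U ⊆ S`, every edge of `M` is *crossing*
(`|U ∩ e| = 1`), *internal* (`e ⊆ U`) or *external* (`e ∩ U = ∅`); `|U| = #crossing + 2·#internal`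
and Rothvoß's `|δ(U) ∩ M|` [Rothvoß 2017, §2] is `#crossing`. We count the sets `U ⊆ S` with `a` crossing
and `b` internal edges — `C(|M|, a+b)·C(a+b, b)·2^a` (`card_filter_cr_in_eq`) — and, for a sub-matching
`E ⊆ M` with covered vertex set `W` and a prescribed trace `U ∩ W = B`, the fibre
`#{U : a crossing, b internal, U ∩ W = B} = C(|M|-|E|, a-y+b-z)·C(a-y+b-z, b-z)·2^{a-y}` (`card_fiber_eq`),
where `y, z` are the numbers of edges of `E` crossing resp. inside `B`. These two counting identities give
the pattern law `P_{Q_c}[π] = 2^{-y}[c]_y[(t-c)/2]_z[(n-t-c)/2]_{x-y-z}/[n/2]_x` (part B).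

Notation used in the docstrings only (the file introduces no definitions; everything is inline):
`#cr(U,M) := #{e ∈ M | cutCount U e = 1}`, `#in(U,M) := #{e ∈ M | cutCount U e = 2}`,
`N(S,M;a,b) := #{U ⊆ S | #cr(U,M) = a ∧ #in(U,M) = b}`, `T(m;a,b) := C(m,a+b)·C(a+b,b)·2^a`,
`W(S,E) := {v ∈ S | ∃ e ∈ E, v ∈ e}`.
-/

set_option linter.dupNamespace false -- `Summit.PneNP.PneNP.…`: summit = sub-problem (D-0017)

namespace Summit.PneNP.PneNP.Theorems.ChebyshevTracialDesignJunta

open Finset Literature.Barriers.PneNP Literature.Combinatorics.SimpleGraph.CycleSpace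

variable {V : Type*} [DecidableEq V]

/-! ### Crossing / internal edge counts -/

/-- `Crosses U e ↔ |U ∩ e| = 1`. [folklore] -/
theorem crosses_iff_cutCount_eq_one (U : Finset V) (e : Sym2 V) : Crosses U e ↔ cutCount U e = 1 := by
  induction e using Sym2.ind with
  | h a b =>
    rw [crosses_mk, cutCount_mk]
    by_cases ha : a ∈ U <;> by_cases hb : b ∈ U <;> simp [ha, hb]

/-- Rothvoß's `cc U M = |δ(U) ∩ M|` is the crossing count `#cr(U,M)`. [cite: Rothvoss2017, §2 (PDF p. 5)] -/
theorem cc_eq_card_filter {n : ℕ} (U : OddSet n) (M : PMatch n) :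
    cc U M = (M.1.filter fun e => cutCount U.1 e = 1).card := by
  unfold cc
  congr 1
  exact filter_congr fun e _ => crosses_iff_cutCount_eq_one U.1 e

/-- `|U| = #cr + 2·#in` for a perfect matching of `S ⊇ U`. [cite: Rothvoss2017, §2 (PDF p. 6)] -/
theorem card_eq_cr_add_two_mul_in {S U : Finset V} {M : Finset (Sym2 V)} (h : IsPMOn S M)
    (hU : U ⊆ S) :
    U.card = (M.filter fun e => cutCount U e = 1).card + 2 * (M.filter fun e => cutCount U e = 2).card := by
  rw [h.card_eq_sum_cutCount hU, sum_cutCount_eq]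

/-! ### Locality and additivity -/

/-- `cutCount` of an edge inside `S₁` only sees `U ∩ S₁`. [folklore] -/
theorem cutCount_inter {U S₁ : Finset V} {e : Sym2 V} (he : e ∈ S₁.sym2) :
    cutCount (U ∩ S₁) e = cutCount U e := by
  induction e using Sym2.ind with
  | h a b =>
    rw [mem_sym2_iff] at he
    have ha : a ∈ S₁ := he a (Sym2.mem_mk_left a b)
    have hb : b ∈ S₁ := he b (Sym2.mem_mk_right a b)
    simp [cutCount_mk, mem_inter, ha, hb]

/-- The `cutCount = k` count of an edge set inside `S₁` only sees `U ∩ S₁`. [folklore] -/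
theorem card_filter_cutCount_inter {U S₁ : Finset V} {M₁ : Finset (Sym2 V)} (h₁ : M₁ ⊆ S₁.sym2) (k : ℕ) :
    (M₁.filter fun e => cutCount (U ∩ S₁) e = k).card = (M₁.filter fun e => cutCount U e = k).card := by
  congr 1
  exact filter_congr fun e he => by rw [cutCount_inter (h₁ he)]

/-- Additivity of the `cutCount = k` count over a disjoint union of edge sets. [folklore] -/
theorem card_filter_cutCount_union {U : Finset V} {M₁ M₂ : Finset (Sym2 V)} (hd : Disjoint M₁ M₂) (k : ℕ) :
    ((M₁ ∪ M₂).filter fun e => cutCount U e = k).card =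
      (M₁.filter fun e => cutCount U e = k).card + (M₂.filter fun e => cutCount U e = k).card := by
  rw [filter_union, card_union_of_disjoint (disjoint_filter_filter hd)]

omit [DecidableEq V] in
/-- Edge sets inside disjoint vertex sets are disjoint. [folklore] -/
theorem disjoint_of_subset_sym2 {S₁ S₂ : Finset V} {M₁ M₂ : Finset (Sym2 V)} (hd : Disjoint S₁ S₂)
    (h₁ : M₁ ⊆ S₁.sym2) (h₂ : M₂ ⊆ S₂.sym2) : Disjoint M₁ M₂ := by
  rw [disjoint_left]
  intro e he₁ he₂
  induction e using Sym2.ind with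
  | h a b =>
    exact disjoint_left.1 hd (mem_sym2_iff.1 (h₁ he₁) a (Sym2.mem_mk_left a b))
      (mem_sym2_iff.1 (h₂ he₂) a (Sym2.mem_mk_left a b))

/-! ### The fibre over a prescribed trace -/

/-- **Fibre count.** For disjoint vertex blocks `S₁, S₂` carrying edge sets `M₁, M₂` and a prescribed
trace `B ⊆ S₁`, the subsets `U ⊆ S₁ ∪ S₂` with `a` crossing and `b` internal edges of `M₁ ∪ M₂` and
`U ∩ S₁ = B` are in bijection (`U ↦ U ∩ S₂`) with the subsets of `S₂` having `a − y` crossing and `b − z`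
internal edges of `M₂`, `y = #cr(B,M₁)`, `z = #in(B,M₁)`. [folklore] -/
theorem card_fiber {S₁ S₂ : Finset V} {M₁ M₂ : Finset (Sym2 V)} (hd : Disjoint S₁ S₂)
    (h₁ : M₁ ⊆ S₁.sym2) (h₂ : M₂ ⊆ S₂.sym2) {B : Finset V} (hB : B ⊆ S₁) (a b : ℕ) :
    ((S₁ ∪ S₂).powerset.filter fun U =>
        ((M₁ ∪ M₂).filter fun e => cutCount U e = 1).card = a ∧
        ((M₁ ∪ M₂).filter fun e => cutCount U e = 2).card = b ∧ U ∩ S₁ = B).card =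
      if (M₁.filter fun e => cutCount B e = 1).card ≤ a ∧ (M₁.filter fun e => cutCount B e = 2).card ≤ b then
        (S₂.powerset.filter fun U =>
          (M₂.filter fun e => cutCount U e = 1).card = a - (M₁.filter fun e => cutCount B e = 1).card ∧
          (M₂.filter fun e => cutCount U e = 2).card = b - (M₁.filter fun e => cutCount B e = 2).card).card
      else 0 := by
  have hdM : Disjoint M₁ M₂ := disjoint_of_subset_sym2 hd h₁ h₂
  -- the counts of any `U` with `U ∩ S₁ = B` split as `B`-part plus `(U ∩ S₂)`-part
  have hsplit : ∀ (U : Finset V) (k : ℕ), U ∩ S₁ = B →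
      ((M₁ ∪ M₂).filter fun e => cutCount U e = k).card =
        (M₁.filter fun e => cutCount B e = k).card + (M₂.filter fun e => cutCount (U ∩ S₂) e = k).card := by
    intro U k hU
    rw [card_filter_cutCount_union hdM, ← card_filter_cutCount_inter h₁, hU, card_filter_cutCount_inter h₂]
  split_ifs with hle
  · refine card_nbij' (fun U => U ∩ S₂) (fun U₂ => B ∪ U₂) ?_ ?_ ?_ ?_
    · intro U hU
      simp only [mem_coe, mem_filter, mem_powerset] at hU ⊢
      obtain ⟨-, ha, hb, hUB⟩ := hU
      have h1 := hsplit U 1 hUB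
      have h2 := hsplit U 2 hUB
      refine ⟨inter_subset_right, ?_, ?_⟩ <;> omega
    · intro U₂ hU₂
      simp only [mem_coe, mem_filter, mem_powerset] at hU₂ ⊢
      obtain ⟨hU₂S, ha, hb⟩ := hU₂
      have hUB : (B ∪ U₂) ∩ S₁ = B := by
        rw [union_inter_distrib_right, inter_eq_left.2 hB]
        have : U₂ ∩ S₁ = ∅ := disjoint_iff_inter_eq_empty.1 (disjoint_of_subset_left hU₂S hd.symm)
        rw [this, union_empty]
      have hU2 : (B ∪ U₂) ∩ S₂ = U₂ := by
        rw [union_inter_distrib_right, inter_eq_left.2 hU₂S]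
        have : B ∩ S₂ = ∅ := disjoint_iff_inter_eq_empty.1 (disjoint_of_subset_left hB hd)
        rw [this, empty_union]
      have h1 := hsplit (B ∪ U₂) 1 hUB
      have h2 := hsplit (B ∪ U₂) 2 hUB
      rw [hU2] at h1 h2
      refine ⟨union_subset_union hB hU₂S, ?_, ?_, hUB⟩ <;> omega
    · intro U hU
      rw [mem_coe, mem_filter, mem_powerset] at hU
      obtain ⟨hUS, -, -, hUB⟩ := hU
      show B ∪ U ∩ S₂ = U
      rw [← hUB, ← inter_union_distrib_left, inter_eq_left.2 hUS]
    · intro U₂ hU₂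
      rw [mem_coe, mem_filter, mem_powerset] at hU₂
      show (B ∪ U₂) ∩ S₂ = U₂
      rw [union_inter_distrib_right, inter_eq_left.2 hU₂.1]
      have : B ∩ S₂ = ∅ := disjoint_iff_inter_eq_empty.1 (disjoint_of_subset_left hB hd)
      rw [this, empty_union]
  · rw [card_eq_zero, filter_eq_empty_iff]
    intro U _ ⟨ha, hb, hUB⟩
    have h1 := hsplit U 1 hUB
    have h2 := hsplit U 2 hUB
    omega

/-- **Partition by the trace on `S₁`**: `N(S₁ ∪ S₂, M₁ ∪ M₂; a, b) = Σ_{B ⊆ S₁}` fibre counts. [folklore] -/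
theorem card_filter_union_eq_sum {S₁ S₂ : Finset V} {M₁ M₂ : Finset (Sym2 V)} (hd : Disjoint S₁ S₂)
    (h₁ : M₁ ⊆ S₁.sym2) (h₂ : M₂ ⊆ S₂.sym2) (a b : ℕ) :
    ((S₁ ∪ S₂).powerset.filter fun U =>
        ((M₁ ∪ M₂).filter fun e => cutCount U e = 1).card = a ∧
        ((M₁ ∪ M₂).filter fun e => cutCount U e = 2).card = b).card =
      ∑ B ∈ S₁.powerset,
        if (M₁.filter fun e => cutCount B e = 1).card ≤ a ∧ (M₁.filter fun e => cutCount B e = 2).card ≤ b then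
          (S₂.powerset.filter fun U =>
            (M₂.filter fun e => cutCount U e = 1).card = a - (M₁.filter fun e => cutCount B e = 1).card ∧
            (M₂.filter fun e => cutCount U e = 2).card = b - (M₁.filter fun e => cutCount B e = 2).card).card
        else 0 := by
  rw [card_eq_sum_card_fiberwise (f := fun U => U ∩ S₁) (t := S₁.powerset)
    (fun U _ => mem_powerset.2 inter_subset_right)]
  refine sum_congr rfl fun B hB => ?_
  rw [filter_filter]
  exact (congrArg Finset.card (filter_congr fun U _ => by tauto)).trans
    (card_fiber hd h₁ h₂ (mem_powerset.1 hB) a b)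

/-! ### One edge at a time: the recursion and the closed form -/

/-- Sum over the four subsets of a pair. [folklore] -/
theorem sum_powerset_pair {β : Type*} [AddCommMonoid β] {u v : V} (huv : u ≠ v) (f : Finset V → β) :
    ∑ B ∈ ({u, v} : Finset V).powerset, f B = f ∅ + f {v} + (f {u} + f {u, v}) := by
  have hu : u ∉ ({v} : Finset V) := by simp [huv]
  have hpow : ({v} : Finset V).powerset = {∅, {v}} := by
    ext B; simp [Finset.subset_singleton_iff]
  have hne : (∅ : Finset V) ≠ {v} := (Finset.singleton_ne_empty v).symm
  rw [sum_powerset_insert hu, hpow, sum_pair hne, sum_pair hne, Finset.insert_empty]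

/-- The traces of the four subsets of an edge `{u, v}` on the one-edge matching: `∅` crosses nothing,
`{u}` and `{v}` cross once, `{u, v}` is internal. [folklore] -/
theorem traces_pair {u v : V} (huv : u ≠ v) :
    ((({s(u, v)} : Finset (Sym2 V)).filter fun e => cutCount (∅ : Finset V) e = 1).card = 0 ∧
      (({s(u, v)} : Finset (Sym2 V)).filter fun e => cutCount (∅ : Finset V) e = 2).card = 0) ∧
    ((({s(u, v)} : Finset (Sym2 V)).filter fun e => cutCount ({v} : Finset V) e = 1).card = 1 ∧
      (({s(u, v)} : Finset (Sym2 V)).filter fun e => cutCount ({v} : Finset V) e = 2).card = 0) ∧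
    ((({s(u, v)} : Finset (Sym2 V)).filter fun e => cutCount ({u} : Finset V) e = 1).card = 1 ∧
      (({s(u, v)} : Finset (Sym2 V)).filter fun e => cutCount ({u} : Finset V) e = 2).card = 0) ∧
    ((({s(u, v)} : Finset (Sym2 V)).filter fun e => cutCount ({u, v} : Finset V) e = 1).card = 0 ∧
      (({s(u, v)} : Finset (Sym2 V)).filter fun e => cutCount ({u, v} : Finset V) e = 2).card = 1) := by
  simp [filter_singleton, cutCount_mk, huv, huv.symm]

/-- **Peeling one edge**: the count over `{u,v} ⊔ S₂` with the edge `uv` added satisfies the multinomial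
recursion (the new edge is external, crossing with one of two inner endpoints, or internal). [folklore] -/
theorem card_filter_cons {S₂ : Finset V} {M₂ : Finset (Sym2 V)} {u v : V} (huv : u ≠ v)
    (hu : u ∉ S₂) (hv : v ∉ S₂) (h₂ : M₂ ⊆ S₂.sym2) (a b : ℕ) :
    ((({u, v} : Finset V) ∪ S₂).powerset.filter fun U =>
        ((({s(u, v)} : Finset (Sym2 V)) ∪ M₂).filter fun e => cutCount U e = 1).card = a ∧
        ((({s(u, v)} : Finset (Sym2 V)) ∪ M₂).filter fun e => cutCount U e = 2).card = b).card =
      (S₂.powerset.filter fun U =>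
          (M₂.filter fun e => cutCount U e = 1).card = a ∧ (M₂.filter fun e => cutCount U e = 2).card = b).card +
      (if 1 ≤ a then 2 * (S₂.powerset.filter fun U =>
          (M₂.filter fun e => cutCount U e = 1).card = a - 1 ∧
          (M₂.filter fun e => cutCount U e = 2).card = b).card else 0) +
      (if 1 ≤ b then (S₂.powerset.filter fun U =>
          (M₂.filter fun e => cutCount U e = 1).card = a ∧
          (M₂.filter fun e => cutCount U e = 2).card = b - 1).card else 0) := by
  have hd : Disjoint ({u, v} : Finset V) S₂ := by simp [hu, hv]
  have h₁ : ({s(u, v)} : Finset (Sym2 V)) ⊆ ({u, v} : Finset V).sym2 := by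
    intro e he
    rw [mem_singleton] at he
    subst he
    simp
  obtain ⟨⟨h00, h01⟩, ⟨h10, h11⟩, ⟨h20, h21⟩, ⟨h30, h31⟩⟩ := traces_pair huv
  rw [card_filter_union_eq_sum hd h₁ h₂, sum_powerset_pair huv]
  simp only [h00, h01, h10, h11, h20, h21, h30, h31, zero_le, and_true, true_and, Nat.sub_zero, if_true]
  split_ifs <;> ring

/-- The closed form `T(m;a,b) = C(m,a+b)·C(a+b,b)·2^a` satisfies the same recursion (Pascal twice).
[folklore] -/
theorem T_succ (m a b : ℕ) : (m + 1).choose (a + b) * (a + b).choose b * 2 ^ a =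
    m.choose (a + b) * (a + b).choose b * 2 ^ a +
      (if 1 ≤ a then 2 * (m.choose (a - 1 + b) * (a - 1 + b).choose b * 2 ^ (a - 1)) else 0) +
      (if 1 ≤ b then m.choose (a + (b - 1)) * (a + (b - 1)).choose (b - 1) * 2 ^ a else 0) := by
  rcases a with _ | a <;> rcases b with _ | b
  · simp
  · rw [if_neg (by omega), if_pos (by omega)]
    simp only [zero_add, Nat.add_sub_cancel, Nat.choose_self, mul_one, add_zero]
    rw [Nat.choose_succ_succ]
    ring
  · rw [if_pos (by omega), if_neg (by omega)]
    simp only [add_zero, Nat.add_sub_cancel, Nat.choose_zero_right, mul_one]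
    rw [Nat.choose_succ_succ, pow_succ]
    ring
  · rw [if_pos (by omega), if_pos (by omega), Nat.add_sub_cancel, Nat.add_sub_cancel]
    have e1 : a + 1 + (b + 1) = a + b + 1 + 1 := by ring
    have e3 : a + (b + 1) = a + b + 1 := by ring
    have e5 : a + 1 + b = a + b + 1 := by ring
    rw [e1, e3, e5, Nat.choose_succ_succ m (a + b + 1), Nat.choose_succ_succ (a + b + 1) b, pow_succ]
    ring

/-- **Closed form** `N(S,M;a,b) = T(|M|;a,b)` for a perfect matching `M` of `S` with `k` edges.
[folklore] -/
theorem card_filter_cr_in_eq_T : ∀ (k : ℕ) {S : Finset V} {M : Finset (Sym2 V)}, IsPMOn S M → M.card = k →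
    ∀ a b, (S.powerset.filter fun U =>
        (M.filter fun e => cutCount U e = 1).card = a ∧ (M.filter fun e => cutCount U e = 2).card = b).card =
      k.choose (a + b) * (a + b).choose b * 2 ^ a := by
  intro k
  induction k with
  | zero =>
    intro S M h hM a b
    have hM0 : M = ∅ := card_eq_zero.1 hM
    have hS0 : S = ∅ := by
      rw [eq_empty_iff_forall_notMem]
      intro v hv
      obtain ⟨e, he, -⟩ := h.exists_mem hv
      rw [hM0] at he
      exact notMem_empty e he
    subst hM0
    subst hS0
    by_cases hab : a = 0 ∧ b = 0
    · obtain ⟨rfl, rfl⟩ := hab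
      simp
    · have hlt : 0 < a + b := by omega
      simp only [powerset_empty, filter_singleton, Finset.filter_empty, card_empty,
        Nat.choose_eq_zero_of_lt hlt, zero_mul]
      rw [if_neg (by omega)]
      rfl
  | succ k ih =>
    intro S M h hM a b
    obtain ⟨e, he⟩ : M.Nonempty := card_pos.1 (by omega)
    obtain ⟨u, v, rfl⟩ : ∃ u v, s(u, v) = e := by
      induction e using Sym2.ind with
      | h u v => exact ⟨u, v, rfl⟩
    have huv : u ≠ v := fun h' => h.not_isDiag he (Sym2.mk_isDiag_iff.2 h')
    have hu : u ∈ S := h.mem_of_mem he (Sym2.mem_mk_left u v)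
    have hv : v ∈ S := h.mem_of_mem he (Sym2.mem_mk_right u v)
    have hpair : ({u, v} : Finset V) ⊆ S := by
      rw [insert_subset_iff, singleton_subset_iff]; exact ⟨hu, hv⟩
    have hS : S = {u, v} ∪ (S \ {u, v}) := (union_sdiff_of_subset hpair).symm
    have hMeq : M = {s(u, v)} ∪ M.erase s(u, v) := by rw [← insert_eq, insert_erase he]
    have hd : Disjoint ({u, v} : Finset V) (S \ {u, v}) := disjoint_sdiff
    have h' : IsPMOn ({u, v} ∪ (S \ {u, v})) M := by rwa [← hS]
    have h₂ : IsPMOn (S \ {u, v}) (M.erase s(u, v)) := by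
      rw [← sdiff_singleton_eq_erase]
      exact h'.sdiff hd (IsPMOn.pair huv) (singleton_subset_iff.2 he)
    have hcard : (M.erase s(u, v)).card = k := by rw [card_erase_of_mem he, hM]; rfl
    rw [hS, hMeq, card_filter_cons huv (by simp) (by simp) h₂.1 a b]
    simp only [ih h₂ hcard]
    rw [T_succ]

/-- **Closed form**, card version: `#{U ⊆ S : a crossing, b internal} = C(|M|,a+b)·C(a+b,b)·2^a`.
[folklore] -/
theorem card_filter_cr_in_eq {S : Finset V} {M : Finset (Sym2 V)} (h : IsPMOn S M) (a b : ℕ) :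
    (S.powerset.filter fun U =>
        (M.filter fun e => cutCount U e = 1).card = a ∧ (M.filter fun e => cutCount U e = 2).card = b).card =
      M.card.choose (a + b) * (a + b).choose b * 2 ^ a :=
  card_filter_cr_in_eq_T M.card h rfl a b

/-! ### Sub-matchings and their vertex sets -/

/-- A sub-edge-set of a perfect matching lives on the vertices `W(S,E)` it covers. [folklore] -/
theorem subset_sym2_verts {S : Finset V} {M E : Finset (Sym2 V)} (h : IsPMOn S M) (hE : E ⊆ M) :
    E ⊆ (S.filter fun v => ∃ e ∈ E, v ∈ e).sym2 := by
  intro e he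
  rw [mem_sym2_iff]
  intro a ha
  exact mem_filter.2 ⟨h.mem_of_mem (hE he) ha, e, he, ha⟩

/-- A sub-edge-set of a perfect matching is a perfect matching of the vertices it covers. [folklore] -/
theorem isPMOn_verts {S : Finset V} {M E : Finset (Sym2 V)} (h : IsPMOn S M) (hE : E ⊆ M) :
    IsPMOn (S.filter fun v => ∃ e ∈ E, v ∈ e) E := by
  refine ⟨subset_sym2_verts h hE, fun e he => h.not_isDiag (hE he), fun v hv => ?_⟩
  obtain ⟨-, e₀, he₀, hv₀⟩ := mem_filter.1 hv
  have : E.filter (fun e => v ∈ e) = {e₀} := by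
    ext e
    simp only [mem_filter, mem_singleton]
    exact ⟨fun he => h.unique (hE he.1) (hE he₀) he.2 hv₀, fun he => he ▸ ⟨he₀, hv₀⟩⟩
  rw [this, card_singleton]

/-- Removing a sub-matching leaves a perfect matching of the remaining vertices. [folklore] -/
theorem isPMOn_sdiff_verts {S : Finset V} {M E : Finset (Sym2 V)} (h : IsPMOn S M) (hE : E ⊆ M) :
    IsPMOn (S \ S.filter fun v => ∃ e ∈ E, v ∈ e) (M \ E) := by
  have h' : IsPMOn ((S.filter fun v => ∃ e ∈ E, v ∈ e) ∪ (S \ S.filter fun v => ∃ e ∈ E, v ∈ e)) M := by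
    rwa [union_sdiff_of_subset (filter_subset _ S)]
  exact h'.sdiff disjoint_sdiff (isPMOn_verts h hE) hE

/-- **Fibre count against a perfect matching**: for a perfect matching `M` of `S`, a sub-matching
`E ⊆ M` with covered vertex set `W`, and a prescribed trace `B ⊆ W` with `y` crossing and `z` internal
`E`-edges, the number of `U ⊆ S` with `a` crossing and `b` internal `M`-edges and `U ∩ W = B` is
`T(|M| − |E|; a − y, b − z)` if `y ≤ a` and `z ≤ b`, and `0` otherwise. [folklore] -/
theorem card_fiber_eq {S : Finset V} {M E : Finset (Sym2 V)} (h : IsPMOn S M) (hE : E ⊆ M)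
    {B : Finset V} (hB : B ⊆ S.filter fun v => ∃ e ∈ E, v ∈ e) (a b : ℕ) :
    (S.powerset.filter fun U =>
        (M.filter fun e => cutCount U e = 1).card = a ∧ (M.filter fun e => cutCount U e = 2).card = b ∧
        U ∩ (S.filter fun v => ∃ e ∈ E, v ∈ e) = B).card =
      if (E.filter fun e => cutCount B e = 1).card ≤ a ∧ (E.filter fun e => cutCount B e = 2).card ≤ b then
        (M.card - E.card).choose
            (a - (E.filter fun e => cutCount B e = 1).card + (b - (E.filter fun e => cutCount B e = 2).card)) *
          (a - (E.filter fun e => cutCount B e = 1).card + (b - (E.filter fun e => cutCount B e = 2).card)).choose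
            (b - (E.filter fun e => cutCount B e = 2).card) *
          2 ^ (a - (E.filter fun e => cutCount B e = 1).card)
      else 0 := by
  have hS : S = (S.filter fun v => ∃ e ∈ E, v ∈ e) ∪ (S \ S.filter fun v => ∃ e ∈ E, v ∈ e) :=
    (union_sdiff_of_subset (filter_subset _ S)).symm
  have hM : M = E ∪ (M \ E) := (union_sdiff_of_subset hE).symm
  have h₂ := isPMOn_sdiff_verts h hE
  have key := card_fiber (disjoint_sdiff (s := S.filter fun v => ∃ e ∈ E, v ∈ e) (t := S))
    (subset_sym2_verts h hE) h₂.1 hB a b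
  rw [← hS, ← hM] at key
  rw [key]
  split_ifs
  · rw [card_filter_cr_in_eq h₂, card_sdiff_of_subset hE]
  · rfl

end Summit.PneNP.PneNP.Theorems.ChebyshevTracialDesignJunta
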